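import Summits.BirchSwinnertonDyer.BirchSwinnertonDyer.Theorems.UniversalToricDescentResidualGrowthOfRankOne
import Literature.NumberTheory.EllipticCurves.IwasawaAlgebraProofs
import Mathlib.NumberTheory.Padics.RingHoms
import HarnessLib

/-!
# Residual growth of a rank-one `Λ`-module with `μ(torsion) = 0`

Support file for crux `stmt-BirchSwinnertonDyer-24737` (`TwinAlgMuZeroAtThree`, line `beta-road` v7, stub K2_res ∣ β; brick E7 of
the LEAD's STUB BRIEF), companion of `…ResidualGrowthOfRankOne`: the finiteness input `#(t/p·t) < ∞` of
`residual_growth_of_rank_one` is discharged from `μ(t) = 0` (`μ = 0` iff finitely generated over `ℤ_p`, Washington §13.2, tree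
`muInvariant_eq_zero_iff_finite`; a finitely generated `ℤ_p`-module mod `p` is finite), giving the μ-form
`residual_growth_of_rank_one_of_muInvariant_eq_zero`: rank one and `μ(M_tors) = 0` ⟹ `#((M/pM) ⧸ T^{pⁿ}) ≤ p^{pⁿ + C}` —
the exact converse of g21's `…ResidualCorankOneCriterion.muInvariant_torsion_eq_zero_of_residual_growth`.

References: Washington, *Introduction to Cyclotomic Fields*, §13.2.
-/

set_option linter.dupNamespace false
set_option autoImplicit false

noncomputable section
open scoped Classical
open PowerSeries

namespace Summit.BirchSwinnertonDyer.BirchSwinnertonDyer.Theorems.UniversalToricDescentResidualGrowthOfRankOne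

open Literature.NumberTheory.EllipticCurves Literature.NumberTheory.EllipticCurves.IwasawaAlgebra

variable {p : ℕ} [hp : Fact p.Prime]

/-- A finitely generated `ℤ_p`-module killed by `p` is finite (a finitely generated module over the finite ring
`ℤ_p/(p) ≅ 𝔽_p`). [folklore] -/
theorem finite_of_padicInt_p_smul_eq_zero {N : Type*} [AddCommGroup N] [Module ℤ_[p] N] [Module.Finite ℤ_[p] N]
    (h : ∀ x : N, (p : ℤ_[p]) • x = 0) : Finite N := by
  set I : Ideal ℤ_[p] := Ideal.span {(p : ℤ_[p])} with hI
  have htors : Module.IsTorsionBySet ℤ_[p] N ↑I := by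
    intro x ⟨a, ha⟩
    obtain ⟨b, rfl⟩ := Ideal.mem_span_singleton'.mp ha
    change (b * (p : ℤ_[p])) • x = 0
    rw [mul_smul, h, smul_zero]
  letI := htors.module
  haveI : IsScalarTower ℤ_[p] (ℤ_[p] ⧸ I) N := htors.isScalarTower
  haveI : Module.Finite (ℤ_[p] ⧸ I) N := Module.Finite.of_restrictScalars_finite ℤ_[p] _ _
  haveI : Finite (ℤ_[p] ⧸ I) := by
    have hk : RingHom.ker (PadicInt.toZMod : ℤ_[p] →+* ZMod p) = I := by
      rw [PadicInt.ker_toZMod, PadicInt.maximalIdeal_eq_span_p]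
    exact Finite.of_equiv (ZMod p)
      ((Ideal.quotEquivOfEq hk.symm).trans
        (RingHom.quotientKerEquivOfSurjective (ZMod.ringHom_surjective PadicInt.toZMod))).symm.toEquiv
  exact Module.finite_of_finite (ℤ_[p] ⧸ I)

/-- **`μ(T) = 0` ⟹ `T/p·T` is finite** for a finitely generated torsion `Λ`-module `T`: `μ = 0` makes `T` finitely generated
over `ℤ_p` (Washington §13.2), and `T/pT` is then a finitely generated `ℤ_p`-module killed by `p`. [cite: Washington1997, §13.2] -/
theorem finite_quotient_augIdealP_of_muInvariant_eq_zero {T : Type*} [AddCommGroup T] [Module (IwasawaAlgebra p) T]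
    [Module.Finite (IwasawaAlgebra p) T] (hT : Module.IsTorsion (IwasawaAlgebra p) T) (hμ : muInvariant p T = 0) :
    Finite (T ⧸ (augIdealP p • (⊤ : Submodule (IwasawaAlgebra p) T))) := by
  letI : Module ℤ_[p] T := Module.compHom T (algebraMap ℤ_[p] (IwasawaAlgebra p))
  haveI : IsScalarTower ℤ_[p] (IwasawaAlgebra p) T := IsScalarTower.of_compHom ℤ_[p] _ T
  haveI : Module.Finite ℤ_[p] T := (muInvariant_eq_zero_iff_finite p T hT).mp hμ
  set P : Submodule (IwasawaAlgebra p) T := augIdealP p • ⊤ with hP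
  letI : Module ℤ_[p] (T ⧸ P) := Module.compHom (T ⧸ P) (algebraMap ℤ_[p] (IwasawaAlgebra p))
  haveI : IsScalarTower ℤ_[p] (IwasawaAlgebra p) (T ⧸ P) := IsScalarTower.of_compHom ℤ_[p] _ (T ⧸ P)
  haveI : Module.Finite ℤ_[p] (T ⧸ P) :=
    Module.Finite.of_surjective (P.mkQ.restrictScalars ℤ_[p]) (Submodule.mkQ_surjective P)
  refine finite_of_padicInt_p_smul_eq_zero (p := p) fun x ↦ ?_
  obtain ⟨y, rfl⟩ := Submodule.mkQ_surjective P x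
  have hCp : algebraMap ℤ_[p] (IwasawaAlgebra p) (p : ℤ_[p]) = PowerSeries.C (p : ℤ_[p]) := by
    rw [map_natCast, map_natCast]
  change (algebraMap ℤ_[p] (IwasawaAlgebra p) (p : ℤ_[p])) • P.mkQ y = 0
  rw [hCp, ← map_smul, Submodule.mkQ_apply, Submodule.Quotient.mk_eq_zero, hP]
  exact Submodule.smul_mem_smul (Ideal.mem_span_singleton_self _) Submodule.mem_top

variable {M : Type*} [AddCommGroup M] [Module (IwasawaAlgebra p) M]

/-- **Residual growth in rank one, μ-form.** A finitely generated `Λ`-module of rank one with `μ(M_tors) = 0` satisfies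
`#((M/pM) ⧸ T^{pⁿ}) ≤ p^{pⁿ + C}` for some `C` and all `n` — the exact converse of the residual corank-one μ-criterion
(`…ResidualCorankOneCriterion.muInvariant_torsion_eq_zero_of_residual_growth`), in the currency of
`…HowardMuSupply.howardMu_of_residual_growth`. [cite: Washington1997, §13.2] [cite: BourbakiAC5to7, Ch. VII §4 no. 2] -/
theorem residual_growth_of_rank_one_of_muInvariant_eq_zero [Module.Finite (IwasawaAlgebra p) M]
    (hrank : Module.rank (IwasawaAlgebra p) M = 1)
    (hμ : muInvariant p ↥(Submodule.torsion (IwasawaAlgebra p) M) = 0) :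
    ∃ C : ℕ, ∀ n : ℕ, Nat.card ((M ⧸ (augIdealP p • (⊤ : Submodule (IwasawaAlgebra p) M))) ⧸
      (Ideal.span {((PowerSeries.X : IwasawaAlgebra p) ^ (p ^ n))} •
        (⊤ : Submodule (IwasawaAlgebra p) (M ⧸ (augIdealP p • (⊤ : Submodule (IwasawaAlgebra p) M)))))) ≤
      p ^ (p ^ n + C) := by
  haveI : IsNoetherian (IwasawaAlgebra p) M := isNoetherian_of_isNoetherianRing_of_finite _ _
  haveI : Module.Finite (IwasawaAlgebra p) ↥(Submodule.torsion (IwasawaAlgebra p) M) :=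
    Module.Finite.iff_fg.mpr (IsNoetherian.noetherian _)
  exact residual_growth_of_rank_one hrank
    (finite_quotient_augIdealP_of_muInvariant_eq_zero (Submodule.torsion_isTorsion) hμ)

end Summit.BirchSwinnertonDyer.BirchSwinnertonDyer.Theorems.UniversalToricDescentResidualGrowthOfRankOne

end
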